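import Literature.NumberTheory.Transcendental.PkappaThetaAdditionPoly
import Literature.NumberTheory.Transcendental.ThetaAnalytic
import Mathlib.RingTheory.MvPolynomial.WeightedHomogeneous
import Mathlib.Combinatorics.Pigeonhole
import HarnessLib

/-!
# A complete system of polynomial addition laws for the theta model of `M_κ`

Topic: `Literature/NumberTheory/Transcendental`. A brick of the programme towards the named fact
`Literature.NumberTheory.Transcendental.philippon1986_std` (Philippon's zero estimate for the
groups `M_κ = 𝔾ₘ^β × P_κ` in the theta embedding `GaGmE.Std.theta` of `PkappaTheta.lean`),
supplying for the theta model the ADDITION-LAW data of an analytic group model in the sense of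
`ZeroEstModel.lean` (`AnalyticGroupModel`: fields `law`, `degree_law`, `lam`, `analyticOnNhd_lam`,
`eval_law`, `exists_lam_ne_zero`), i.e. D. Roy's "complete system of addition laws"
(Nesterenko–Philippon (eds.), LNM 1752, Ch. 11, §2.1, (84)): finitely many families of polynomials
`A^α_I(X, Y)` in TWO sets of theta variables, with CONSTANT coefficients, homogeneous of degree
`c = 4` in `X`, such that `A^α_I(Θ(w), Θ(z)) = λ^α(w, z) Θ_I(w + z)` for entire `λ^α` and, for
every `(w, z)`, some `λ^α(w, z) ≠ 0`.

`PkappaThetaAddition.lean` proved the law `μ(w,u) Θ_I(w + u) = ∑ T_a(u) c(u) Θ(w)Θ(w)` with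
coefficients ENTIRE IN `u`; here these coefficients are themselves expanded as quadratic forms in
`Θ(u)`. PROVED:

* `PeriodPair.chordCoeff₂_swap` — the coefficient tensor `a^{(i)}_{jk;lm}` of the chord law of the
  Weierstrass cubic (`A_i(x, y) = ∑ a^{(i)}_{jk;lm} x_j x_k y_l y_m = -σ(z-t)³ P_i(z+t)` at
  `x = P(z)`, `y = P(t)`) is ANTISYMMETRIC under `(jk) ↔ (lm)` (as it must: `A_i(y, x) = -A_i(x, y)`
  since `σ` is odd) — the identity that makes the `ζ`-companion terms of the fibre coordinates
  recombine into theta functions of `u`;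
* `GaGmE.Std.addCoeffP_eq_sum`, `GaGmE.Std.addCoeffS_eq_sum` — the coefficients `c_{M;JK}(u)`,
  `d^e_{M;JK}(u)` of `PkappaThetaAddition.lean` are quadratic forms in `Θ(u)` with the constant
  tensors `GaGmE.Std.lawA = ∏_b a`, `GaGmE.Std.lawB = -∑_b κ_{eb} c ∏_{b'≠b} a`;
* `GaGmE.Std.theta_add_none₂`, `GaGmE.Std.theta_add_some₂` — **the bihomogeneous `(2,2)` law**
  `μ(w, u) Θ_I(w + u) = ∑ (const) · Θ(w)Θ(w) · Θ(u)Θ(u)` for ALL `w, u`;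
* `GaGmE.Std.bilaw I ∈ ℂ[X, Y]` (`eval_bilaw`, weighted-homogeneous of degree `2` in `X` and in
  `Y`), and the **composite laws** `GaGmE.Std.claw s I = bilaw_I(Q^{(-s)}(X), Q^{(s)}(Y))` through an
  auxiliary point `s` (degree `4` in `X`, `claw_isWeightedHomogeneous`), with
  `claw_{s,I}(Θ(w), Θ(z)) = U_s(w, z) Θ_I(w + z)` for ALL `w, z` (`eval_claw`), unit
  `U_s(w,z) = μ(w,-s)² μ(z,s)² μ(w-s,z+s)` entire on `V × V` (`analyticOnNhd_clawUnit`);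
* **completeness with finitely many laws** (`exists_clawUnit_clawPt_ne_zero`): for the `3|γ|+1`
  auxiliary points `s^{(i)} = i·c` on the `E`-blocks (`c` generic: `2kc ∉ Λ`, `0 < k ≤ 3|γ|`), at
  every `(w, z)` some `U_{s^{(i)}}(w, z) ≠ 0` — pigeonhole over (block, failure type): two laws
  failing for the same reason on the same block force `2(i-j)c ∈ Λ`;
* the summary `GaGmE.Std.exists_complete_addition_laws` in the shape of the fields of
  `AnalyticGroupModel` (indexed by the theta indices; reindexing by `Fin (N+1)` is left to the
  instance file).

Generic lemmas: scaling of weighted-homogeneous polynomials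
(`eval_pow_weight_mul_of_isWeightedHomogeneous`), weighted homogeneity under `bind₁` and under
`rename Sum.inl/inr`. Only real definitions (the constant tensors `lawA/lawB`, the polynomials
`bilaw/claw`, the unit `clawUnit`, the weights `wX/wY`, the auxiliary points
`clawPt/clawScalar/clawFamily` and their number `nClaw`); no named facts.

## References

* Yu. V. Nesterenko, P. Philippon (eds.), *Introduction to Algebraic Independence Theory*,
  LNM 1752, Springer 2001, Ch. 11 (D. Roy), §2.1 (addition laws (84), complete systems, `c(G)`).
  [NesterenkoPhilippon2001]
* H. Lange, W. Ruppert, *Complete systems of addition laws on abelian varieties*, Invent. Math.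
  79 (1985), 603–610. [LangeRuppert1985]
* P. Philippon, *Lemmes de zéros dans les groupes algébriques commutatifs*, Bull. Soc. Math.
  France 114 (1986), 355–383, §2. [Philippon1986]
-/

noncomputable section

open Complex MvPolynomial Set
open scoped PeriodPair

namespace Literature.NumberTheory.Transcendental

/-! ### Antisymmetry of the chord tensor -/

set_option maxHeartbeats 1000000 in
-- 243 numerical cases of the explicit table
/-- **Pair antisymmetry of the chord tensor**: `a^{(i)}_{lm;jk} = -a^{(i)}_{jk;lm}`
(`A_i(y, x) = -A_i(x, y)`, `σ` being odd). [folklore] -/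
theorem _root_.PeriodPair.chordCoeff₂_swap (L : PeriodPair) (i j k l m : Fin 3) :
    L.chordCoeff₂ i l m j k = -L.chordCoeff₂ i j k l m := by
  fin_cases i <;> fin_cases j <;> fin_cases k <;> fin_cases l <;> fin_cases m <;>
    norm_num [PeriodPair.chordCoeff₂]

/-! ### Weighted-homogeneous polynomials: scaling and substitution -/

/-- **Scaling a weighted-homogeneous polynomial**: `φ(c^{w_i} x_i) = c^n φ(x)` for `φ`
weighted-homogeneous of degree `n`. [folklore] -/
theorem eval_pow_weight_mul_of_isWeightedHomogeneous {ι : Type*} {wt : ι → ℕ} {φ : MvPolynomial ι ℂ}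
    {n : ℕ} (h : IsWeightedHomogeneous wt φ n) (c : ℂ) (x : ι → ℂ) :
    eval (fun i => c ^ wt i * x i) φ = c ^ n * eval x φ := by
  classical
  simp only [eval_eq, Finset.mul_sum]
  refine Finset.sum_congr rfl fun d hd => ?_
  have hdeg : ∑ i ∈ d.support, d i * wt i = n := by
    have h' := h (mem_support_iff.mp hd)
    rw [Finsupp.weight_apply, Finsupp.sum] at h'
    simpa only [smul_eq_mul] using h'
  have hprod : ∏ i ∈ d.support, (c ^ wt i * x i) ^ d i = c ^ n * ∏ i ∈ d.support, x i ^ d i := by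
    rw [← hdeg, ← Finset.prod_pow_eq_pow_sum, ← Finset.prod_mul_distrib]
    exact Finset.prod_congr rfl fun i _ => by rw [mul_pow, ← pow_mul']
  rw [hprod]
  ring

/-- **Substitution into a weighted-homogeneous polynomial**: if `φ` is `w₁`-homogeneous of degree
`d` and each `h i` is `w₂`-homogeneous of degree `c · w₁ i`, then `φ(h)` is `w₂`-homogeneous of
degree `c · d`. [folklore] -/
theorem _root_.MvPolynomial.IsWeightedHomogeneous.bind₁_of_weights {σ τ : Type*} {w₁ : σ → ℕ}
    {w₂ : τ → ℕ} {φ : MvPolynomial σ ℂ} {d : ℕ} (hφ : IsWeightedHomogeneous w₁ φ d) (c : ℕ)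
    {h : σ → MvPolynomial τ ℂ} (hh : ∀ i, IsWeightedHomogeneous w₂ (h i) (c * w₁ i)) :
    IsWeightedHomogeneous w₂ (bind₁ h φ) (c * d) := by
  classical
  rw [← aeval_eq_bind₁, MvPolynomial.aeval_def, MvPolynomial.eval₂_eq]
  refine IsWeightedHomogeneous.sum _ _ _ fun s hs => ?_
  have hdeg : ∑ i ∈ s.support, s i * (c * w₁ i) = c * d := by
    have h' := hφ (mem_support_iff.mp hs)
    rw [Finsupp.weight_apply, Finsupp.sum] at h'
    rw [← h', Finset.mul_sum]
    exact Finset.sum_congr rfl fun i _ => by rw [smul_eq_mul]; ring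
  have hprod := IsWeightedHomogeneous.prod s.support (fun i => h i ^ s i) (fun i => s i * (c * w₁ i))
    fun i _ => by simpa only [smul_eq_mul] using (hh i).pow (s i)
  rw [← zero_add (c * d)]
  exact (isWeightedHomogeneous_C _ _).mul (hdeg ▸ hprod)

/-- Renaming variables transports weighted homogeneity along the weights. [folklore] -/
theorem isWeightedHomogeneous_rename {σ τ : Type*} (f : σ → τ) (w : τ → ℕ) {P : MvPolynomial σ ℂ}
    {n : ℕ} (hP : IsWeightedHomogeneous (w ∘ f) P n) : IsWeightedHomogeneous w (rename f P) n := by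
  intro d hd
  obtain ⟨u, rfl, hu⟩ := coeff_rename_ne_zero _ _ _ hd
  rw [← hP hu, Finsupp.weight_apply, Finsupp.weight_apply,
    Finsupp.sum_mapDomain_index (h := fun i c => c • w i) (fun _ => zero_smul _ _)
      (fun _ _ _ => add_smul _ _ _)]
  rfl

/-- Any polynomial is homogeneous of degree `0` for the zero weights. [folklore] -/
theorem isWeightedHomogeneous_zero_weights {σ : Type*} (P : MvPolynomial σ ℂ) :
    IsWeightedHomogeneous (fun _ : σ => (0 : ℕ)) P 0 := fun d _ => by
  simp [Finsupp.weight_apply]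

/-- The weights `(1, 0)` on `ℂ[X, Y] = MvPolynomial (ι ⊕ ι) ℂ` (degree in `X`). [folklore] -/
abbrev wX (ι : Type*) : ι ⊕ ι → ℕ := Sum.elim (fun _ => 1) fun _ => 0

/-- The weights `(0, 1)` on `ℂ[X, Y]` (degree in `Y`). [folklore] -/
abbrev wY (ι : Type*) : ι ⊕ ι → ℕ := Sum.elim (fun _ => 0) fun _ => 1

/-- A form of degree `n` in the `X`-variables has `X`-degree `n`. [folklore] -/
theorem isWeightedHomogeneous_wX_rename_inl {ι : Type*} {P : MvPolynomial ι ℂ} {n : ℕ}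
    (hP : P.IsHomogeneous n) : IsWeightedHomogeneous (wX ι) (rename Sum.inl P) n :=
  isWeightedHomogeneous_rename Sum.inl (wX ι) hP

/-- A polynomial in the `Y`-variables has `X`-degree `0`. [folklore] -/
theorem isWeightedHomogeneous_wX_rename_inr {ι : Type*} (P : MvPolynomial ι ℂ) :
    IsWeightedHomogeneous (wX ι) (rename Sum.inr P) 0 :=
  isWeightedHomogeneous_rename Sum.inr (wX ι) (isWeightedHomogeneous_zero_weights P)

/-- A polynomial in the `X`-variables has `Y`-degree `0`. [folklore] -/
theorem isWeightedHomogeneous_wY_rename_inl {ι : Type*} (P : MvPolynomial ι ℂ) :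
    IsWeightedHomogeneous (wY ι) (rename Sum.inl P) 0 :=
  isWeightedHomogeneous_rename Sum.inl (wY ι) (isWeightedHomogeneous_zero_weights P)

/-- A form of degree `n` in the `Y`-variables has `Y`-degree `n`. [folklore] -/
theorem isWeightedHomogeneous_wY_rename_inr {ι : Type*} {P : MvPolynomial ι ℂ} {n : ℕ}
    (hP : P.IsHomogeneous n) : IsWeightedHomogeneous (wY ι) (rename Sum.inr P) n :=
  isWeightedHomogeneous_rename Sum.inr (wY ι) hP

/-- The monomials `c · X_{i₁} X_{i₂} Y_{i₃} Y_{i₄}` of the law and their weighted degrees.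
[folklore] -/
theorem isWeightedHomogeneous_CXXXX {ι : Type*} (wt : ι → ℕ) (c : ℂ) (i₁ i₂ i₃ i₄ : ι) :
    IsWeightedHomogeneous wt (C c * ((X i₁ * X i₂) * (X i₃ * X i₄)) : MvPolynomial ι ℂ)
      (wt i₁ + wt i₂ + (wt i₃ + wt i₄)) := by
  have h := (isWeightedHomogeneous_C wt c).mul
    (((isWeightedHomogeneous_X (R := ℂ) wt i₁).mul (isWeightedHomogeneous_X (R := ℂ) wt i₂)).mul
      ((isWeightedHomogeneous_X (R := ℂ) wt i₃).mul (isWeightedHomogeneous_X (R := ℂ) wt i₄)))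
  rwa [zero_add] at h

namespace GaGmE

namespace Std

variable {β γ δ : Type} [Fintype β] [Fintype γ] [Fintype δ] [DecidableEq γ]
variable (L : PeriodPair) (κM : δ → γ → Kbar)

/-! ### The constant tensors of the law -/

/-- **The block tensor** `A_{M;JK;PQ} = ∏_b a^{(M_b)}_{J_bK_b;P_bQ_b}`. [folklore] -/
def lawA (M J K P Q : γ → Fin 3) : ℂ :=
  ∏ b, L.chordCoeff₂ (M b) (J b) (K b) (P b) (Q b)

/-- **The fibre tensor** `B^e_{M;JK;PQ} = -∑_b κ_{eb} c^{(M_b)}_{J_bK_b;P_bQ_b} ∏_{b'≠b} a^{(M_{b'})}_{J_{b'}K_{b'};P_{b'}Q_{b'}}`.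
[folklore] -/
def lawB (M : γ → Fin 3) (e : δ) (J K P Q : γ → Fin 3) : ℂ :=
  -∑ b, (κM e b : ℂ) * (L.chordC₂ (M b) (J b) (K b) (P b) (Q b) *
    ∏ b' ∈ Finset.univ.erase b, L.chordCoeff₂ (M b') (J b') (K b') (P b') (Q b'))

/-! ### The coefficients of the law as quadratic forms in `Θ(u)` -/

omit [Fintype β] [Fintype δ] in
/-- `c_{M;JK}(u) = ∑_{P,Q} A_{M;JK;PQ} Θ^P_{(P,none)}(u) Θ^P_{(Q,none)}(u)`. [folklore] -/
theorem addCoeffP_eq_sum (M J K : γ → Fin 3) (u : β ⊕ (γ ⊕ δ) → ℂ) :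
    addCoeffP L M J K u = ∑ P : γ → Fin 3, ∑ Q : γ → Fin 3,
      lawA L M J K P Q * (thetaPnone (β := β) (δ := δ) L P u * thetaPnone (β := β) (δ := δ) L Q u) := by
  unfold addCoeffP lawA thetaPnone
  simp_rw [PeriodPair.chordCoeff_eq_sum]
  rw [prod_sum_sum_eq (fun b l m => L.chordCoeff₂ (M b) (J b) (K b) l m) (blockP L u) (blockP L u)]
  simp only [blockP_apply]

omit [Fintype β] [Fintype δ] in
/-- Segre expansion with one marked block carrying the vector `v` instead of `P(t'_b)`:
`∑_{P,Q} A_{M;JK;PQ} (v_{P_b} ∏_{b'≠b} P_{P_{b'}}) Θ^P_Q = (∑_{l,m} a^{(M_b)}_{J_bK_b;lm} v_l P_m(t'_b)) ∏_{b'≠b} α(P(t'_{b'}))`.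
[folklore] -/
theorem sum_lawA_marked (M J K : γ → Fin 3) (u : β ⊕ (γ ⊕ δ) → ℂ) (b : γ) (v : Fin 3 → ℂ) :
    ∑ P : γ → Fin 3, ∑ Q : γ → Fin 3, lawA L M J K P Q *
        ((v (P b) * ∏ b' ∈ Finset.univ.erase b, blockP L u b' (P b')) *
          thetaPnone (β := β) (δ := δ) L Q u) =
      (∑ l : Fin 3, ∑ m : Fin 3, L.chordCoeff₂ (M b) (J b) (K b) l m * (v l * blockP L u b m)) *
        ∏ b' ∈ Finset.univ.erase b, L.chordCoeff (M b') (J b') (K b') (blockP L u b') := by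
  have h := prod_sum_sum_eq (fun b' l m => L.chordCoeff₂ (M b') (J b') (K b') l m)
    (Function.update (blockP L u) b v) (blockP L u)
  rw [← Finset.mul_prod_erase _ _ (Finset.mem_univ b), Function.update_self] at h
  have hl : ∏ b' ∈ Finset.univ.erase b, ∑ l : Fin 3, ∑ m : Fin 3,
      L.chordCoeff₂ (M b') (J b') (K b') l m * (Function.update (blockP L u) b v b' l * blockP L u b' m) =
      ∏ b' ∈ Finset.univ.erase b, L.chordCoeff (M b') (J b') (K b') (blockP L u b') := by
    refine Finset.prod_congr rfl fun b' hb' => ?_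
    rw [Function.update_of_ne (Finset.ne_of_mem_erase hb'), L.chordCoeff_eq_sum]
  rw [hl] at h
  rw [h]
  refine Finset.sum_congr rfl fun P _ => Finset.sum_congr rfl fun Q _ => ?_
  have hu : (∏ b', Function.update (blockP L u) b v b' (P b')) =
      v (P b) * ∏ b' ∈ Finset.univ.erase b, blockP L u b' (P b') := by
    rw [← Finset.mul_prod_erase _ _ (Finset.mem_univ b), Function.update_self]
    exact congrArg _ (Finset.prod_congr rfl fun b' hb' => by
      rw [Function.update_of_ne (Finset.ne_of_mem_erase hb')])
  rw [hu]
  simp only [lawA, thetaPnone, blockP_apply]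

omit [Fintype β] [Fintype δ] in
/-- Segre expansion with one marked block carrying the correction tensor `c` instead of `a`:
`∑_{P,Q} c^{(M_b)}_{J_bK_b;P_bQ_b} ∏_{b'≠b} a_{…;P_{b'}Q_{b'}} Θ^P_P Θ^P_Q = γ^{(M_b)}_{J_bK_b}(P(t'_b)) ∏_{b'≠b} α(P(t'_{b'}))`.
[folklore] -/
theorem sum_lawC_marked (M J K : γ → Fin 3) (u : β ⊕ (γ ⊕ δ) → ℂ) (b : γ) :
    ∑ P : γ → Fin 3, ∑ Q : γ → Fin 3,
        (L.chordC₂ (M b) (J b) (K b) (P b) (Q b) *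
            ∏ b' ∈ Finset.univ.erase b, L.chordCoeff₂ (M b') (J b') (K b') (P b') (Q b')) *
          (thetaPnone (β := β) (δ := δ) L P u * thetaPnone (β := β) (δ := δ) L Q u) =
      L.chordCcoeff (M b) (J b) (K b) (blockP L u b) *
        ∏ b' ∈ Finset.univ.erase b, L.chordCoeff (M b') (J b') (K b') (blockP L u b') := by
  have h := prod_sum_sum_eq
    (Function.update (fun b' l m => L.chordCoeff₂ (M b') (J b') (K b') l m) b
      (fun l m => L.chordC₂ (M b) (J b) (K b) l m))
    (blockP L u) (blockP L u)
  rw [← Finset.mul_prod_erase _ _ (Finset.mem_univ b), Function.update_self] at h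
  have hl : ∏ b' ∈ Finset.univ.erase b, ∑ l : Fin 3, ∑ m : Fin 3,
      Function.update (fun b' l m => L.chordCoeff₂ (M b') (J b') (K b') l m) b
        (fun l m => L.chordC₂ (M b) (J b) (K b) l m) b' l m * (blockP L u b' l * blockP L u b' m) =
      ∏ b' ∈ Finset.univ.erase b, L.chordCoeff (M b') (J b') (K b') (blockP L u b') := by
    refine Finset.prod_congr rfl fun b' hb' => ?_
    rw [Function.update_of_ne (Finset.ne_of_mem_erase hb'), L.chordCoeff_eq_sum]
  rw [hl] at h
  rw [show L.chordCcoeff (M b) (J b) (K b) (blockP L u b) =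
      ∑ l : Fin 3, ∑ m : Fin 3, L.chordC₂ (M b) (J b) (K b) l m * (blockP L u b l * blockP L u b m)
    from rfl, h]
  refine Finset.sum_congr rfl fun P _ => Finset.sum_congr rfl fun Q _ => ?_
  have hu : (∏ b', Function.update (fun b' l m => L.chordCoeff₂ (M b') (J b') (K b') l m) b
        (fun l m => L.chordC₂ (M b) (J b) (K b) l m) b' (P b') (Q b')) =
      L.chordC₂ (M b) (J b) (K b) (P b) (Q b) *
        ∏ b' ∈ Finset.univ.erase b, L.chordCoeff₂ (M b') (J b') (K b') (P b') (Q b') := by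
    rw [← Finset.mul_prod_erase _ _ (Finset.mem_univ b), Function.update_self]
    exact congrArg _ (Finset.prod_congr rfl fun b' hb' => by
      rw [Function.update_of_ne (Finset.ne_of_mem_erase hb')])
  rw [hu]
  simp only [thetaPnone, blockP_apply]

/-- Bringing the innermost of three sums outside. [folklore] -/
private theorem sum_comm₃ {α₁ α₂ α₃ : Type*} [Fintype α₁] [Fintype α₂] [Fintype α₃]
    (f : α₁ → α₂ → α₃ → ℂ) : ∑ x, ∑ y, ∑ z, f x y z = ∑ z, ∑ x, ∑ y, f x y z :=
  calc ∑ x, ∑ y, ∑ z, f x y z = ∑ x, ∑ z, ∑ y, f x y z :=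
        Finset.sum_congr rfl fun _ _ => Finset.sum_comm
    _ = ∑ z, ∑ x, ∑ y, f x y z := Finset.sum_comm

omit [Fintype β] [Fintype δ] in
/-- **The fibre coefficients as quadratic forms in `Θ(u)`**:
`d^e_{M;JK}(u) = ∑_{P,Q} A_{M;JK;PQ} Θ^P_{(P,some e)}(u) Θ^P_{(Q,none)}(u) + ∑_{P,Q} B^e_{M;JK;PQ} Θ^P_{(P,none)}(u) Θ^P_{(Q,none)}(u)`
— the `ζ(t'_b)`-terms of `d^e` are exactly those of the fibre sections at `u`, by the pair
antisymmetry of the chord tensor. [folklore] -/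
theorem addCoeffS_eq_sum (M : γ → Fin 3) (e : δ) (J K : γ → Fin 3) (u : β ⊕ (γ ⊕ δ) → ℂ) :
    addCoeffS L κM M e J K u =
      ∑ P : γ → Fin 3, ∑ Q : γ → Fin 3,
          lawA L M J K P Q * (thetaPsome (β := β) L κM P e u * thetaPnone (β := β) (δ := δ) L Q u) +
        ∑ P : γ → Fin 3, ∑ Q : γ → Fin 3,
          lawB L κM M e J K P Q * (thetaPnone (β := β) (δ := δ) L P u * thetaPnone (β := β) (δ := δ) L Q u) := by
  -- the `A`-part: `u(is e) c(u) - ∑_b κ_{eb} (∑_{lm} a_{JK;lm} Z_l P_m)(t'_b) ∏_{b'≠b} α`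
  have h1 : ∑ P : γ → Fin 3, ∑ Q : γ → Fin 3,
      lawA L M J K P Q * (thetaPsome (β := β) L κM P e u * thetaPnone (β := β) (δ := δ) L Q u) =
      u (is e) * addCoeffP L M J K u -
        ∑ b, (κM e b : ℂ) * ((∑ l : Fin 3, ∑ m : Fin 3,
          L.chordCoeff₂ (M b) (J b) (K b) l m * (blockZ L u b l * blockP L u b m)) *
            ∏ b' ∈ Finset.univ.erase b, L.chordCoeff (M b') (J b') (K b') (blockP L u b')) := by
    have hsplit : ∀ P Q : γ → Fin 3,
        lawA L M J K P Q * (thetaPsome (β := β) L κM P e u * thetaPnone (β := β) (δ := δ) L Q u) =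
        u (is e) * (lawA L M J K P Q *
            (thetaPnone (β := β) (δ := δ) L P u * thetaPnone (β := β) (δ := δ) L Q u)) -
          ∑ b, (κM e b : ℂ) * (lawA L M J K P Q *
            ((blockZ L u b (P b) * ∏ b' ∈ Finset.univ.erase b, blockP L u b' (P b')) *
              thetaPnone (β := β) (δ := δ) L Q u)) := by
      intro P Q
      simp only [thetaPsome, ← blockZ_apply, ← blockP_apply, sub_mul, mul_sub, Finset.sum_mul,
        Finset.mul_sum]
      congr 1
      · ring
      · exact Finset.sum_congr rfl fun b _ => by ring
    simp only [hsplit, Finset.sum_sub_distrib, ← Finset.mul_sum, ← addCoeffP_eq_sum]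
    congr 1
    rw [sum_comm₃]
    refine Finset.sum_congr rfl fun b _ => ?_
    rw [← sum_lawA_marked L M J K u b (blockZ L u b)]
    simp only [Finset.mul_sum]
  -- the `B`-part: `-∑_b κ_{eb} γ(P(t'_b)) ∏_{b'≠b} α`
  have h2 : ∑ P : γ → Fin 3, ∑ Q : γ → Fin 3,
      lawB L κM M e J K P Q * (thetaPnone (β := β) (δ := δ) L P u * thetaPnone (β := β) (δ := δ) L Q u) =
      -∑ b, (κM e b : ℂ) * (L.chordCcoeff (M b) (J b) (K b) (blockP L u b) *
        ∏ b' ∈ Finset.univ.erase b, L.chordCoeff (M b') (J b') (K b') (blockP L u b')) := by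
    have hsplit : ∀ P Q : γ → Fin 3,
        lawB L κM M e J K P Q * (thetaPnone (β := β) (δ := δ) L P u * thetaPnone (β := β) (δ := δ) L Q u) =
        -∑ b, (κM e b : ℂ) * ((L.chordC₂ (M b) (J b) (K b) (P b) (Q b) *
            ∏ b' ∈ Finset.univ.erase b, L.chordCoeff₂ (M b') (J b') (K b') (P b') (Q b')) *
          (thetaPnone (β := β) (δ := δ) L P u * thetaPnone (β := β) (δ := δ) L Q u)) := by
      intro P Q
      simp only [lawB, neg_mul, Finset.sum_mul, neg_inj]
      exact Finset.sum_congr rfl fun b _ => by ring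
    simp only [hsplit, Finset.sum_neg_distrib, neg_inj]
    rw [sum_comm₃]
    refine Finset.sum_congr rfl fun b _ => ?_
    rw [← sum_lawC_marked L M J K u b]
    simp only [Finset.mul_sum]
  -- the antisymmetry turns the `Z`-form of the `A`-part into the one of `d^e`
  have hkey : ∀ b, (∑ l : Fin 3, ∑ m : Fin 3,
      L.chordCoeff₂ (M b) (J b) (K b) l m * (blockZ L u b l * blockP L u b m)) =
      -∑ j : Fin 3, ∑ k : Fin 3, L.chordCoeff₂ (M b) j k (J b) (K b) * (blockZ L u b j * blockP L u b k) := by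
    intro b
    simp only [← Finset.sum_neg_distrib]
    refine Finset.sum_congr rfl fun l _ => Finset.sum_congr rfl fun m _ => ?_
    rw [L.chordCoeff₂_swap (M b) (J b) (K b) l m]
    ring
  rw [h1, h2]
  simp only [hkey, addCoeffS]
  rw [sub_eq_add_neg, add_assoc]
  congr 1
  rw [← Finset.sum_neg_distrib, ← Finset.sum_neg_distrib, ← Finset.sum_add_distrib]
  exact Finset.sum_congr rfl fun b _ => by ring

/-! ### The bihomogeneous law on the theta functions -/

omit [Fintype β] [Fintype δ] in
/-- **The `(2,2)` addition law of the theta model, block coordinates**: for ALL `w, u`,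
`μ(w,u) Θ_{(a,(M,none))}(w+u) = ∑_{J,K,P,Q} A_{M;JK;PQ} Θ_{(a,(J,none))}(w) Θ_{(none,(K,none))}(w) Θ_{(a,(P,none))}(u) Θ_{(none,(Q,none))}(u)`.
[cite: NesterenkoPhilippon2001, Ch. 11 §2.1 (84)] -/
theorem theta_add_none₂ (a : Option β) (M : γ → Fin 3) (w u : β ⊕ (γ ⊕ δ) → ℂ) :
    addUnit (β := β) (δ := δ) L w u * theta L κM (a, (M, none)) (w + u) =
      ∑ J : γ → Fin 3, ∑ K : γ → Fin 3, ∑ P : γ → Fin 3, ∑ Q : γ → Fin 3, lawA L M J K P Q *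
        ((theta L κM (a, (J, none)) w * theta L κM (none, (K, none)) w) *
          (theta L κM (a, (P, none)) u * theta L κM (none, (Q, none)) u)) := by
  rw [theta_add_none]
  refine Finset.sum_congr rfl fun J _ => Finset.sum_congr rfl fun K _ => ?_
  rw [addCoeffP_eq_sum, Finset.mul_sum, Finset.sum_mul]
  refine Finset.sum_congr rfl fun P _ => ?_
  rw [Finset.mul_sum, Finset.sum_mul]
  refine Finset.sum_congr rfl fun Q _ => ?_
  simp only [theta, thetaP_none, thetaT_none, one_mul]
  ring

omit [Fintype β] [Fintype δ] in
/-- **The `(2,2)` addition law of the theta model, fibre coordinates**: for ALL `w, u`,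
`μ(w,u) Θ_{(a,(M,some e))}(w+u) = ∑ A·Θ_{(a,(J,some e))}(w)Θ^P_K(w)Θ_{(a,(P,none))}(u)Θ^P_Q(u)
  + ∑ A·Θ_{(a,(J,none))}(w)Θ^P_K(w)Θ_{(a,(P,some e))}(u)Θ^P_Q(u) + ∑ B^e·Θ_{(a,(J,none))}(w)Θ^P_K(w)Θ_{(a,(P,none))}(u)Θ^P_Q(u)`.
[cite: NesterenkoPhilippon2001, Ch. 11 §2.1 (84)] -/
theorem theta_add_some₂ (a : Option β) (M : γ → Fin 3) (e : δ) (w u : β ⊕ (γ ⊕ δ) → ℂ) :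
    addUnit (β := β) (δ := δ) L w u * theta L κM (a, (M, some e)) (w + u) =
      ∑ J : γ → Fin 3, ∑ K : γ → Fin 3, ∑ P : γ → Fin 3, ∑ Q : γ → Fin 3,
        (lawA L M J K P Q *
            ((theta L κM (a, (J, some e)) w * theta L κM (none, (K, none)) w) *
              (theta L κM (a, (P, none)) u * theta L κM (none, (Q, none)) u)) +
          lawA L M J K P Q *
            ((theta L κM (a, (J, none)) w * theta L κM (none, (K, none)) w) *
              (theta L κM (a, (P, some e)) u * theta L κM (none, (Q, none)) u)) +
          lawB L κM M e J K P Q *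
            ((theta L κM (a, (J, none)) w * theta L κM (none, (K, none)) w) *
              (theta L κM (a, (P, none)) u * theta L κM (none, (Q, none)) u))) := by
  rw [theta_add_some, ← Finset.sum_add_distrib]
  refine Finset.sum_congr rfl fun J _ => ?_
  rw [← Finset.sum_add_distrib]
  refine Finset.sum_congr rfl fun K _ => ?_
  rw [addCoeffP_eq_sum, addCoeffS_eq_sum]
  simp only [Finset.mul_sum, Finset.sum_mul, mul_add, add_mul, ← Finset.sum_add_distrib]
  refine Finset.sum_congr rfl fun P _ => Finset.sum_congr rfl fun Q _ => ?_
  simp only [theta, thetaP_none, thetaP_some, thetaT_none, one_mul]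
  ring

/-! ### The law as polynomials in two sets of theta variables -/

/-- **The `(2,2)` addition law of the theta model as polynomials with constant coefficients**
`A_I(X, Y) ∈ ℂ[X_J, Y_J]`: `A_I(Θ(w), Θ(u)) = μ(w, u) Θ_I(w + u)` (`eval_bilaw`).
[cite: NesterenkoPhilippon2001, Ch. 11 §2.1 (84)] -/
def bilaw : Option β × ThetaIdx γ δ →
    MvPolynomial ((Option β × ThetaIdx γ δ) ⊕ (Option β × ThetaIdx γ δ)) ℂ
  | (a, (M, none)) => ∑ J : γ → Fin 3, ∑ K : γ → Fin 3, ∑ P : γ → Fin 3, ∑ Q : γ → Fin 3,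
      C (lawA L M J K P Q) *
        ((X (Sum.inl (a, (J, none))) * X (Sum.inl (none, (K, none)))) *
          (X (Sum.inr (a, (P, none))) * X (Sum.inr (none, (Q, none)))))
  | (a, (M, some e)) => ∑ J : γ → Fin 3, ∑ K : γ → Fin 3, ∑ P : γ → Fin 3, ∑ Q : γ → Fin 3,
      (C (lawA L M J K P Q) *
          ((X (Sum.inl (a, (J, some e))) * X (Sum.inl (none, (K, none)))) *
            (X (Sum.inr (a, (P, none))) * X (Sum.inr (none, (Q, none))))) +
        C (lawA L M J K P Q) *
          ((X (Sum.inl (a, (J, none))) * X (Sum.inl (none, (K, none)))) *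
            (X (Sum.inr (a, (P, some e))) * X (Sum.inr (none, (Q, none))))) +
        C (lawB L κM M e J K P Q) *
          ((X (Sum.inl (a, (J, none))) * X (Sum.inl (none, (K, none)))) *
            (X (Sum.inr (a, (P, none))) * X (Sum.inr (none, (Q, none))))))

omit [Fintype β] [Fintype δ] in
/-- **`A_I(Θ(w), Θ(u)) = μ(w, u) Θ_I(w + u)`** for ALL `w, u`. [cite: NesterenkoPhilippon2001, Ch. 11 §2.1 (84)] -/
theorem eval_bilaw (I : Option β × ThetaIdx γ δ) (w u : β ⊕ (γ ⊕ δ) → ℂ) :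
    eval (Sum.elim (fun J => theta L κM J w) fun J => theta L κM J u) (bilaw L κM I) =
      addUnit (β := β) (δ := δ) L w u * theta L κM I (w + u) := by
  obtain ⟨a, M, _ | e⟩ := I
  · rw [theta_add_none₂]
    simp [bilaw, map_sum, map_mul, eval_C, eval_X]
  · rw [theta_add_some₂]
    simp [bilaw, map_sum, map_mul, map_add, eval_C, eval_X]

omit [Fintype β] [Fintype δ] in
/-- The law has degree `2` in `X`. [folklore] -/
theorem bilaw_isWeightedHomogeneous_wX (I : Option β × ThetaIdx γ δ) :
    IsWeightedHomogeneous (wX (Option β × ThetaIdx γ δ)) (bilaw L κM I) 2 := by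
  have key : ∀ (c : ℂ) (i₁ i₂ i₃ i₄ : Option β × ThetaIdx γ δ),
      IsWeightedHomogeneous (wX (Option β × ThetaIdx γ δ))
        (C c * ((X (Sum.inl i₁) * X (Sum.inl i₂)) * (X (Sum.inr i₃) * X (Sum.inr i₄))) :
          MvPolynomial ((Option β × ThetaIdx γ δ) ⊕ (Option β × ThetaIdx γ δ)) ℂ) 2 :=
    fun c i₁ i₂ i₃ i₄ => isWeightedHomogeneous_CXXXX (wX _) c (Sum.inl i₁) (Sum.inl i₂) (Sum.inr i₃) (Sum.inr i₄)
  obtain ⟨a, M, _ | e⟩ := I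
  · exact IsWeightedHomogeneous.sum _ _ _ fun J _ => IsWeightedHomogeneous.sum _ _ _ fun K _ =>
      IsWeightedHomogeneous.sum _ _ _ fun P _ => IsWeightedHomogeneous.sum _ _ _ fun Q _ => key _ _ _ _ _
  · exact IsWeightedHomogeneous.sum _ _ _ fun J _ => IsWeightedHomogeneous.sum _ _ _ fun K _ =>
      IsWeightedHomogeneous.sum _ _ _ fun P _ => IsWeightedHomogeneous.sum _ _ _ fun Q _ =>
        ((key _ _ _ _ _).add (key _ _ _ _ _)).add (key _ _ _ _ _)

omit [Fintype β] [Fintype δ] in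
/-- The law has degree `2` in `Y`. [folklore] -/
theorem bilaw_isWeightedHomogeneous_wY (I : Option β × ThetaIdx γ δ) :
    IsWeightedHomogeneous (wY (Option β × ThetaIdx γ δ)) (bilaw L κM I) 2 := by
  have key : ∀ (c : ℂ) (i₁ i₂ i₃ i₄ : Option β × ThetaIdx γ δ),
      IsWeightedHomogeneous (wY (Option β × ThetaIdx γ δ))
        (C c * ((X (Sum.inl i₁) * X (Sum.inl i₂)) * (X (Sum.inr i₃) * X (Sum.inr i₄))) :
          MvPolynomial ((Option β × ThetaIdx γ δ) ⊕ (Option β × ThetaIdx γ δ)) ℂ) 2 :=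
    fun c i₁ i₂ i₃ i₄ => isWeightedHomogeneous_CXXXX (wY _) c (Sum.inl i₁) (Sum.inl i₂) (Sum.inr i₃) (Sum.inr i₄)
  obtain ⟨a, M, _ | e⟩ := I
  · exact IsWeightedHomogeneous.sum _ _ _ fun J _ => IsWeightedHomogeneous.sum _ _ _ fun K _ =>
      IsWeightedHomogeneous.sum _ _ _ fun P _ => IsWeightedHomogeneous.sum _ _ _ fun Q _ => key _ _ _ _ _
  · exact IsWeightedHomogeneous.sum _ _ _ fun J _ => IsWeightedHomogeneous.sum _ _ _ fun K _ =>
      IsWeightedHomogeneous.sum _ _ _ fun P _ => IsWeightedHomogeneous.sum _ _ _ fun Q _ =>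
        ((key _ _ _ _ _).add (key _ _ _ _ _)).add (key _ _ _ _ _)

/-! ### The composite laws through an auxiliary point (constant coefficients, degree `4`) -/

/-- **The composite law through the auxiliary point `s`**:
`A^{(s)}_I(X, Y) = A_I(Q^{(-s)}(X), Q^{(s)}(Y))`, where `Q^{(u)}_J ∈ ℂ[X]₂` is the specialised law of
`PkappaThetaAdditionPoly.lean` (`Q^{(u)}_J(Θ(w)) = μ(w,u) Θ_J(w+u)`): a polynomial in `(X, Y)` with
constant coefficients, of degree `4` in `X` (and in `Y`), computing `Θ_I(w + z)` through the
intermediate points `w - s`, `z + s`. [cite: NesterenkoPhilippon2001, Ch. 11 §2.1 (complete systems)] -/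
def claw (s : β ⊕ (γ ⊕ δ) → ℂ) (I : Option β × ThetaIdx γ δ) :
    MvPolynomial ((Option β × ThetaIdx γ δ) ⊕ (Option β × ThetaIdx γ δ)) ℂ :=
  bind₁ (Sum.elim (fun I' => rename Sum.inl (addPoly L κM (-s) I'))
    fun I' => rename Sum.inr (addPoly L κM s I')) (bilaw L κM I)

/-- **The unit of the composite law**: `U_s(w, z) = μ(w, -s)² μ(z, s)² μ(w - s, z + s)`. [folklore] -/
def clawUnit (s w z : β ⊕ (γ ⊕ δ) → ℂ) : ℂ :=
  addUnit (β := β) (δ := δ) L w (-s) ^ 2 * addUnit (β := β) (δ := δ) L z s ^ 2 *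
    addUnit (β := β) (δ := δ) L (w - s) (z + s)

omit [Fintype β] [Fintype δ] in
/-- The composite law has degree `4` in `X`. [folklore] -/
theorem claw_isWeightedHomogeneous (s : β ⊕ (γ ⊕ δ) → ℂ) (I : Option β × ThetaIdx γ δ) :
    IsWeightedHomogeneous (Sum.elim (fun _ => (1 : ℕ)) fun _ => 0) (claw L κM s I) 4 :=
  (bilaw_isWeightedHomogeneous_wX L κM I).bind₁_of_weights 2 (by
    rintro (I' | I')
    · exact isWeightedHomogeneous_wX_rename_inl (addPoly_isHomogeneous L κM (-s) I')
    · exact isWeightedHomogeneous_wX_rename_inr _)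

omit [Fintype β] [Fintype δ] in
/-- The composite law has degree `4` in `Y` as well. [folklore] -/
theorem claw_isWeightedHomogeneous_wY (s : β ⊕ (γ ⊕ δ) → ℂ) (I : Option β × ThetaIdx γ δ) :
    IsWeightedHomogeneous (Sum.elim (fun _ => (0 : ℕ)) fun _ => 1) (claw L κM s I) 4 :=
  (bilaw_isWeightedHomogeneous_wY L κM I).bind₁_of_weights 2 (by
    rintro (I' | I')
    · exact isWeightedHomogeneous_wY_rename_inl _
    · exact isWeightedHomogeneous_wY_rename_inr (addPoly_isHomogeneous L κM s I'))

omit [Fintype β] [Fintype δ] in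
/-- **`A^{(s)}_I(Θ(w), Θ(z)) = U_s(w, z) Θ_I(w + z)`** for ALL `w, z` and every auxiliary `s`.
[cite: NesterenkoPhilippon2001, Ch. 11 §2.1 (84)] -/
theorem eval_claw (s : β ⊕ (γ ⊕ δ) → ℂ) (I : Option β × ThetaIdx γ δ) (w z : β ⊕ (γ ⊕ δ) → ℂ) :
    eval (Sum.elim (fun J => theta L κM J w) fun J => theta L κM J z) (claw L κM s I) =
      clawUnit (β := β) (δ := δ) L s w z * theta L κM I (w + z) := by
  have hX : ∀ I', eval (Sum.elim (fun J => theta L κM J w) fun J => theta L κM J z)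
      (rename Sum.inl (addPoly L κM (-s) I')) = addUnit (β := β) (δ := δ) L w (-s) * theta L κM I' (w - s) := by
    intro I'
    rw [eval_rename, sub_eq_add_neg]
    exact thetaEval_addPoly L κM (-s) I' w
  have hY : ∀ I', eval (Sum.elim (fun J => theta L κM J w) fun J => theta L κM J z)
      (rename Sum.inr (addPoly L κM s I')) = addUnit (β := β) (δ := δ) L z s * theta L κM I' (z + s) := by
    intro I'
    rw [eval_rename]
    exact thetaEval_addPoly L κM s I' z
  rw [claw, eval_bind₁]
  have hfun : (fun i => eval (Sum.elim (fun J => theta L κM J w) fun J => theta L κM J z)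
      (Sum.elim (fun I' => rename Sum.inl (addPoly L κM (-s) I'))
        (fun I' => rename Sum.inr (addPoly L κM s I')) i)) =
      fun i => addUnit (β := β) (δ := δ) L w (-s) ^ wX (Option β × ThetaIdx γ δ) i *
        (addUnit (β := β) (δ := δ) L z s ^ wY (Option β × ThetaIdx γ δ) i *
          Sum.elim (fun I' => theta L κM I' (w - s)) (fun I' => theta L κM I' (z + s)) i) := by
    funext i
    rcases i with I' | I'
    · simp [hX]
    · simp [hY]
  rw [hfun, eval_pow_weight_mul_of_isWeightedHomogeneous (bilaw_isWeightedHomogeneous_wX L κM I),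
    eval_pow_weight_mul_of_isWeightedHomogeneous (bilaw_isWeightedHomogeneous_wY L κM I), eval_bilaw,
    clawUnit, show w - s + (z + s) = w + z by abel]
  ring

omit [Fintype β] [Fintype δ] [DecidableEq γ] in
/-- **Where the composite law is good**: `U_s(w, z) ≠ 0` iff, for every block `b`,
`w_b + s_b ∉ Λ`, `z_b - s_b ∉ Λ` and `w_b - s_b - (z_b + s_b) ∉ Λ`. [folklore] -/
theorem clawUnit_ne_zero_iff (s w z : β ⊕ (γ ⊕ δ) → ℂ) :
    clawUnit (β := β) (δ := δ) L s w z ≠ 0 ↔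
      (∀ b, w (iz b) + s (iz b) ∉ L.lattice) ∧ (∀ b, z (iz b) - s (iz b) ∉ L.lattice) ∧
        ∀ b, w (iz b) - s (iz b) - (z (iz b) + s (iz b)) ∉ L.lattice := by
  rw [clawUnit, mul_ne_zero_iff, mul_ne_zero_iff, pow_ne_zero_iff two_ne_zero,
    pow_ne_zero_iff two_ne_zero, addUnit_ne_zero_iff, addUnit_ne_zero_iff, addUnit_ne_zero_iff]
  simp only [Pi.neg_apply, sub_neg_eq_add, Pi.sub_apply, Pi.add_apply, and_assoc]

omit [Fintype β] [Fintype δ] [DecidableEq γ] in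
/-- The composite law is bad at `(w, z)` iff some block is on one of the three diagonals. [folklore] -/
theorem clawUnit_eq_zero_iff (s w z : β ⊕ (γ ⊕ δ) → ℂ) :
    clawUnit (β := β) (δ := δ) L s w z = 0 ↔
      ∃ b, w (iz b) + s (iz b) ∈ L.lattice ∨ z (iz b) - s (iz b) ∈ L.lattice ∨
        w (iz b) - s (iz b) - (z (iz b) + s (iz b)) ∈ L.lattice := by
  have h := clawUnit_ne_zero_iff (β := β) (δ := δ) L s w z
  constructor
  · intro h0
    by_contra hne
    push Not at hne
    exact (h.mpr ⟨fun b => (hne b).1, fun b => (hne b).2.1, fun b => (hne b).2.2⟩) h0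
  · rintro ⟨b, hb⟩
    by_contra h0
    obtain ⟨h1, h2, h3⟩ := h.mp h0
    rcases hb with hb | hb | hb
    exacts [h1 b hb, h2 b hb, h3 b hb]

/-! ### Holomorphy of the unit -/

omit [DecidableEq γ] in
/-- `μ(f(q), g(q))` is analytic in `q` for analytic `f, g`. [folklore] -/
theorem analyticAt_addUnit_comp {E : Type*} [NormedAddCommGroup E] [NormedSpace ℂ E]
    {f g : E → β ⊕ (γ ⊕ δ) → ℂ} {q : E} (hf : AnalyticAt ℂ f q) (hg : AnalyticAt ℂ g q) :
    AnalyticAt ℂ (fun q => addUnit (β := β) (δ := δ) L (f q) (g q)) q := by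
  unfold addUnit
  refine Finset.analyticAt_fun_prod _ fun b _ => ?_
  have hπ : AnalyticAt ℂ (fun w : β ⊕ (γ ⊕ δ) → ℂ => w (iz b)) (f q) :=
    (ContinuousLinearMap.proj (R := ℂ) (φ := fun _ : β ⊕ (γ ⊕ δ) => ℂ) (iz b)).analyticAt _
  have hπ' : AnalyticAt ℂ (fun w : β ⊕ (γ ⊕ δ) → ℂ => w (iz b)) (g q) :=
    (ContinuousLinearMap.proj (R := ℂ) (φ := fun _ : β ⊕ (γ ⊕ δ) => ℂ) (iz b)).analyticAt _
  have hc : AnalyticAt ℂ (fun q => f q (iz b) - g q (iz b)) q := (hπ.comp hf).sub (hπ'.comp hg)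
  exact (((L.differentiable_weierstrassSigma_holds).analyticAt _).comp hc).pow 3 |>.neg

omit [DecidableEq γ] in
/-- **The unit of the composite law is entire on `V × V`.** [folklore] -/
theorem analyticOnNhd_clawUnit (s : β ⊕ (γ ⊕ δ) → ℂ) :
    AnalyticOnNhd ℂ (Function.uncurry (clawUnit (β := β) (δ := δ) L s)) univ := by
  intro p _
  have h1 : AnalyticAt ℂ (fun q : (β ⊕ (γ ⊕ δ) → ℂ) × (β ⊕ (γ ⊕ δ) → ℂ) =>
      addUnit (β := β) (δ := δ) L q.1 (-s)) p :=
    analyticAt_addUnit_comp L analyticAt_fst analyticAt_const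
  have h2 : AnalyticAt ℂ (fun q : (β ⊕ (γ ⊕ δ) → ℂ) × (β ⊕ (γ ⊕ δ) → ℂ) =>
      addUnit (β := β) (δ := δ) L q.2 s) p :=
    analyticAt_addUnit_comp L analyticAt_snd analyticAt_const
  have hf : AnalyticAt ℂ (fun q : (β ⊕ (γ ⊕ δ) → ℂ) × (β ⊕ (γ ⊕ δ) → ℂ) => q.1 - s) p :=
    analyticAt_fst.fun_sub analyticAt_const
  have hg : AnalyticAt ℂ (fun q : (β ⊕ (γ ⊕ δ) → ℂ) × (β ⊕ (γ ⊕ δ) → ℂ) => q.2 + s) p :=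
    analyticAt_snd.fun_add analyticAt_const
  have h3 : AnalyticAt ℂ (fun q : (β ⊕ (γ ⊕ δ) → ℂ) × (β ⊕ (γ ⊕ δ) → ℂ) =>
      addUnit (β := β) (δ := δ) L (q.1 - s) (q.2 + s)) p :=
    analyticAt_addUnit_comp L hf hg
  show AnalyticAt ℂ (fun q : (β ⊕ (γ ⊕ δ) → ℂ) × (β ⊕ (γ ⊕ δ) → ℂ) =>
    addUnit (β := β) (δ := δ) L q.1 (-s) ^ 2 * addUnit (β := β) (δ := δ) L q.2 s ^ 2 *
      addUnit (β := β) (δ := δ) L (q.1 - s) (q.2 + s)) p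
  exact ((h1.fun_pow 2).fun_mul (h2.fun_pow 2)).fun_mul h3

/-! ### Completeness with finitely many auxiliary points -/

/-- The auxiliary points `s^{(i)} = i·c` on every `E`-block (and `0` on the torus and fibre
coordinates). [folklore] -/
def clawPt (c : ℂ) (i : ℕ) : β ⊕ (γ ⊕ δ) → ℂ :=
  fun k => Sum.elim (fun _ => 0) (Sum.elim (fun _ => (i : ℂ) * c) fun _ => 0) k

omit [Fintype β] [Fintype γ] [Fintype δ] [DecidableEq γ] in
/-- The `E`-coordinates of the auxiliary points. [folklore] -/
@[simp] theorem clawPt_iz (c : ℂ) (i : ℕ) (b : γ) : clawPt (β := β) (δ := δ) c i (iz b) = (i : ℂ) * c := by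
  simp [clawPt, iz]

/-- **A generic scalar**: `c` with `2kc ∉ Λ` for `0 < k < m` (countably many exclusions). [folklore] -/
theorem exists_generic_scalar (m : ℕ) : ∃ c : ℂ, ∀ k : ℕ, 0 < k → k < m → 2 * (k : ℂ) * c ∉ L.lattice := by
  have hΛ : (L.lattice : Set ℂ).Countable := by
    have : (L.lattice : Set ℂ) ⊆
        Set.range (fun p : ℤ × ℤ => (p.1 : ℂ) * L.ω₁ + (p.2 : ℂ) * L.ω₂) := by
      intro x hx
      obtain ⟨a, b, h⟩ := PeriodPair.mem_lattice.mp hx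
      exact ⟨(a, b), h⟩
    exact (Set.countable_range _).mono this
  have hbad : (⋃ k ∈ Finset.range m, (fun l : ℂ => l / (2 * (k : ℂ))) '' (L.lattice : Set ℂ)).Countable :=
    Set.Countable.biUnion (Finset.countable_toSet _) fun k _ => hΛ.image _
  obtain ⟨c, hc⟩ := (hbad.dense_compl ℂ).nonempty
  refine ⟨c, fun k hk hkm hmem => hc ?_⟩
  simp only [Set.mem_iUnion, Set.mem_image, Finset.mem_range, SetLike.mem_coe]
  refine ⟨k, hkm, _, hmem, ?_⟩
  have hk' : (k : ℂ) ≠ 0 := Nat.cast_ne_zero.mpr hk.ne'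
  field_simp

omit [Fintype β] [Fintype δ] [DecidableEq γ] in
/-- **Completeness by pigeonhole.** If `3|γ| < m` and `2kc ∉ Λ` for `0 < k < m`, then at every
`(w, z)` one of the composite laws through `s^{(0)}, …, s^{(m-1)}` is good: two laws `i ≠ j` bad for
the same reason on the same block `b` would give `2(i - j)c ∈ Λ`.
[cite: NesterenkoPhilippon2001, Ch. 11 §2.1 (complete systems exist)] -/
theorem exists_clawUnit_clawPt_ne_zero {m : ℕ} (hm : 3 * Fintype.card γ < m) {c : ℂ}
    (hc : ∀ k : ℕ, 0 < k → k < m → 2 * (k : ℂ) * c ∉ L.lattice) (w z : β ⊕ (γ ⊕ δ) → ℂ) :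
    ∃ i : Fin m, clawUnit (β := β) (δ := δ) L (clawPt c i) w z ≠ 0 := by
  by_contra hall
  push Not at hall
  -- the reason `(block, type)` for which law `i` is bad, encoded in `γ ⊕ γ ⊕ γ`
  have hw : ∀ i : Fin m, ∃ t : γ ⊕ (γ ⊕ γ),
      Sum.elim (fun b => w (iz b) + ((i : ℕ) : ℂ) * c ∈ L.lattice)
        (Sum.elim (fun b => z (iz b) - ((i : ℕ) : ℂ) * c ∈ L.lattice)
          fun b => w (iz b) - ((i : ℕ) : ℂ) * c - (z (iz b) + ((i : ℕ) : ℂ) * c) ∈ L.lattice) t := by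
    intro i
    have h0 := hall i
    rw [clawUnit_eq_zero_iff] at h0
    obtain ⟨b, h | h | h⟩ := h0
    · exact ⟨Sum.inl b, by simpa using h⟩
    · exact ⟨Sum.inr (Sum.inl b), by simpa using h⟩
    · exact ⟨Sum.inr (Sum.inr b), by simpa using h⟩
  choose f hf using hw
  obtain ⟨i, j, hij, hfij⟩ := Fintype.exists_ne_map_eq_of_card_lt f (by
    simp only [Fintype.card_sum, Fintype.card_fin]
    omega)
  have key : 2 * (((i : ℕ) : ℂ) - ((j : ℕ) : ℂ)) * c ∈ L.lattice := by
    have hi := hf i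
    have hj := hf j
    rw [hfij] at hi
    generalize f j = t at hi hj
    rcases t with b | b | b
    · simp only [Sum.elim_inl] at hi hj
      have h := L.lattice.sub_mem hi hj
      have h2 := L.lattice.add_mem h h
      convert h2 using 1
      ring
    · simp only [Sum.elim_inr, Sum.elim_inl] at hi hj
      have h := L.lattice.sub_mem hj hi
      have h2 := L.lattice.add_mem h h
      convert h2 using 1
      ring
    · simp only [Sum.elim_inr] at hi hj
      have h := L.lattice.sub_mem hj hi
      convert h using 1
      ring
  rcases Nat.lt_or_gt_of_ne (Fin.val_ne_of_ne hij) with h | h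
  · refine hc (j - i) (Nat.sub_pos_of_lt h) (by omega) ?_
    have hneg := L.lattice.neg_mem key
    convert hneg using 1
    push_cast [Nat.cast_sub h.le]
    ring
  · refine hc (i - j) (Nat.sub_pos_of_lt h) (by omega) ?_
    convert key using 1
    push_cast [Nat.cast_sub h.le]
    ring

/-- The number `3|γ| + 1` of laws of the complete system. [folklore] -/
abbrev nClaw (γ : Type) [Fintype γ] : ℕ := 3 * Fintype.card γ + 1

/-- A generic scalar for `3|γ| + 1` laws (chosen once). [folklore] -/
def clawScalar : ℂ := Classical.choose (exists_generic_scalar L (nClaw γ))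

omit [DecidableEq γ] in
/-- The defining property of `clawScalar`. [folklore] -/
theorem clawScalar_spec : ∀ k : ℕ, 0 < k → k < nClaw γ → 2 * (k : ℂ) * clawScalar (γ := γ) L ∉ L.lattice :=
  Classical.choose_spec (exists_generic_scalar L (nClaw γ))

/-- **The auxiliary points of the complete system.** [folklore] -/
def clawFamily (i : Fin (nClaw γ)) : β ⊕ (γ ⊕ δ) → ℂ := clawPt (clawScalar (γ := γ) L) i

omit [Fintype β] [Fintype δ] [DecidableEq γ] in
/-- **Completeness of the system**: at every `(w, z)` some `U_{s^{(i)}}(w, z) ≠ 0`.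
[cite: NesterenkoPhilippon2001, Ch. 11 §2.1] -/
theorem exists_clawUnit_clawFamily_ne_zero (w z : β ⊕ (γ ⊕ δ) → ℂ) :
    ∃ i : Fin (nClaw γ), clawUnit (β := β) (δ := δ) L (clawFamily (β := β) (δ := δ) L i) w z ≠ 0 :=
  exists_clawUnit_clawPt_ne_zero L (Nat.lt_succ_self _) (clawScalar_spec L) w z

/-- **A complete system of addition laws for the theta model of `M_κ`** in the shape of the
fields `law / degree_law / lam / analyticOnNhd_lam / eval_law / exists_lam_ne_zero` of
`AnalyticGroupModel` (`ZeroEstModel.lean`), indexed by the theta indices: finitely many families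
of polynomials in `(X, Y)` with constant coefficients, of degree `4` in `X`, computing
`Θ_I(w + z)` up to entire units without common zero on `V × V`.
[cite: NesterenkoPhilippon2001, Ch. 11 §2.1 (84)] -/
theorem exists_complete_addition_laws :
    ∃ (n : ℕ) (S : Fin n → β ⊕ (γ ⊕ δ) → ℂ),
      (∀ i I, IsWeightedHomogeneous (Sum.elim (fun _ => (1 : ℕ)) fun _ => 0) (claw L κM (S i) I) 4) ∧
      (∀ i, AnalyticOnNhd ℂ (Function.uncurry (clawUnit (β := β) (δ := δ) L (S i))) univ) ∧
      (∀ i I (w z : β ⊕ (γ ⊕ δ) → ℂ),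
        eval (Sum.elim (fun J => theta L κM J w) fun J => theta L κM J z) (claw L κM (S i) I) =
          clawUnit (β := β) (δ := δ) L (S i) w z * theta L κM I (w + z)) ∧
      ∀ w z : β ⊕ (γ ⊕ δ) → ℂ, ∃ i, clawUnit (β := β) (δ := δ) L (S i) w z ≠ 0 :=
  ⟨nClaw γ, clawFamily (β := β) (δ := δ) L,
    fun i I => claw_isWeightedHomogeneous L κM (clawFamily (β := β) (δ := δ) L i) I,
    fun i => analyticOnNhd_clawUnit L (clawFamily (β := β) (δ := δ) L i),
    fun i I w z => eval_claw L κM (clawFamily (β := β) (δ := δ) L i) I w z,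
    exists_clawUnit_clawFamily_ne_zero L⟩

end Std

end GaGmE

end Literature.NumberTheory.Transcendental

end
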